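import Summits.NavierStokesRegularity.NavierStokesRegularity.Theses.TypeICertificateLadder
import Summits.NavierStokesRegularity.NavierStokesRegularity.Theses.ThreadingFlux
import Literature.Analysis.FluidPDE.VectorCalculus
import HarnessLib.Audit

/-!
# Skeleton line `depletion-ladder` for crux `Target` (stmt-NavierStokesRegularity-1217)

Crux (by name): `Summit.NavierStokesRegularity.NavierStokesRegularity.Theses.TypeICertificateLadder.NoTypeIBlowup`
(= `ThreadingFlux.Target`). Strategist line (unit `cstrat-stmt-NavierStokesRegularity-1217-p1`, wall-breaker gen 1,
2026-08-17). Card: `Lines/depletion-ladder.md`; census: `Cruxes/Target/STRATEGY-CENSUS.md` (wall-breaker edition).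

## Idea
Every line aimed at the LIMIT statement died at a stub kernel-checked equivalent to rate-class Type-I Liouville
(p95070, p119114) or at a perturbative ceiling; the one switch with teeth is the route's own AMPLITUDE LADDER,
re-armed one level above the kernel-checked reach `C < √6 − √2` of the `L^q`-vorticity budgets
(`Theorems/RungReynoldsOne/Negative/BudgetCeiling.lean`) by a NEW rung mechanism: the **depletion constant** `κ̂`
of the `L^∞`-constrained stretching inequality

  `|∫ ω·(∇u) ω| ≤ κ̂ · ‖u‖_∞ · ‖ω‖₂ · ‖∇ω‖₂`,  `ω = curl u`, `div u = 0`,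

in which the self-consistency `ω = curl u` enters a budget CONSTANT (not a symmetry, not a sign). Since
`∫ω·(∇u)ω = ∫ det(u, ω, curl ω)` and `‖∇ω‖₂ = ‖curl ω‖₂`, Cauchy–Schwarz gives `κ̂ ≤ 1`, and the enstrophy member
of the budget family is EXACTLY the case `κ̂ = 1` (`budgetCloses_two_iff`: reach `C < 1`); a depletion constant `κ`
closes the rung `X_C` for every `C < 1/κ` (S2), so `κ < 1/2` gives RUNG TWO (S1 + S2), and the crux follows from
rung two and the DESCENT to rung two (S3) by the ladder glue. S3 is the typed residual of the crux above level
two — it carries the open Type-I Liouville problem and is DECLARED as such (card §Hardest stub); the line's own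
work is S1 (new, falsifiable by a single field: kit j021500/j021517, `Cruxes/Target/Lines/depletion-ladder.md` §Stubs)
and S2 (provable on rung one's infrastructure).

Registered stubs (3): `stub_depletionBelowHalf` (S1) · `stub_rung_of_depletion` (S2) · `stub_descentToRungTwo` (S3).
`NoTypeIBlowup_of_parts : S1 → S2 → S3 → NoTypeIBlowup` is proved below (no sorry); `NoTypeIBlowup_of` /
`Target_of` conclude the crux BY NAME from the three stubs.
-/

noncomputable section

set_option linter.dupNamespace false
set_option linter.unusedVariables false

open Set Function MeasureTheory Filter
open scoped BigOperators RealInnerProductSpace ContDiff Topology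

namespace Summit.NavierStokesRegularity.NavierStokesRegularity.Cruxes.Target.DepletionLadder

local notation "ℝ³" => EuclideanSpace ℝ (Fin 3)

open Literature.Analysis.FluidPDE

/-! ## Definitions (line-local vocabulary; every constant is an existing declaration) -/

/-- **Stretching depletion with constant `κ`.** For every `C²` divergence-free field `u : ℝ³ → ℝ³` bounded
by `M`, with square-integrable vorticity `ω = curl u`, square-integrable vorticity gradient and integrable
stretching density, the vortex-stretching integral obeys
`|∫ ⟪ω, Du ω⟫| ≤ κ · M · ‖ω‖₂ · ‖∇ω‖₂`. Cauchy–Schwarz after `∫⟪ω, Du ω⟫ = ∫ det(u, ω, curl ω)` gives the case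
`κ = 1`; the line conjectures `κ < 1/2` (numerics: kit j021500/j021517 — gradient search over band-limited
divergence-free fields finds nothing above `R = 0.144`; 32 restarts, three resolutions). Integrability binders are explicit (no junk integrals). -/
def StretchingDepletion (κ : ℝ) : Prop :=
  ∀ (u : ℝ³ → ℝ³) (M : ℝ), ContDiff ℝ 2 u → VectorCalculus.IsDivFree u → (∀ x, ‖u x‖ ≤ M) →
    Integrable (fun x => ‖curl u x‖ ^ 2) →
    Integrable (fun x => frobeniusNormSq (fderiv ℝ (curl u) x)) →
    Integrable (fun x => ⟪curl u x, fderiv ℝ u x (curl u x)⟫) →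
    |∫ x, ⟪curl u x, fderiv ℝ u x (curl u x)⟫| ≤
      κ * M * Real.sqrt (∫ x, ‖curl u x‖ ^ 2) * Real.sqrt (∫ x, frobeniusNormSq (fderiv ℝ (curl u) x))

/-- The rung statement `X_C` of the ladder (shape pinned by `TypeICertificateLadder.LadderGlue`): an eventual
dimensionless rate `√(T−t)‖u(t,x)‖ ≤ C√ν` forces a classical extension past `T`. -/
def Rung (C : ℝ) : Prop :=
  ∀ (ν T : ℝ), 0 < ν → 0 < T → ∀ (u : ℝ → ℝ³ → ℝ³) (p : ℝ → ℝ³ → ℝ),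
    IsClassicalNSSolutionOn (Set.Ico 0 T) ν 0 u p → IsLerayHopfOn T ν 0 (u 0) u →
    HasRapidSpatialDecay (u 0) →
    (∀ᶠ t in 𝓝[<] T, ∀ x, Real.sqrt (T - t) * ‖u t x‖ ≤ C * Real.sqrt ν) →
    HasSmoothExtensionPast ν 0 u T

/-- **Descent to rung two** (the typed residual of the crux above collapse Reynolds number two; child
`DescentToRungTwo` of the strategist's prepared split): for every `C ≥ 2`, a Type-I(`C`) classical Leray–Hopf
rapidly-decaying-datum solution that does NOT extend past `T` eventually has rate `≤ 2√ν`. -/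
def DescentToRungTwo : Prop :=
  ∀ C : ℝ, 2 ≤ C → ∀ (ν T : ℝ), 0 < ν → 0 < T → ∀ (u : ℝ → ℝ³ → ℝ³) (p : ℝ → ℝ³ → ℝ),
    IsClassicalNSSolutionOn (Set.Ico 0 T) ν 0 u p → IsLerayHopfOn T ν 0 (u 0) u →
    HasRapidSpatialDecay (u 0) →
    (∀ᶠ t in 𝓝[<] T, ∀ x, Real.sqrt (T - t) * ‖u t x‖ ≤ C * Real.sqrt ν) →
    ¬ HasSmoothExtensionPast ν 0 u T →
    ∀ᶠ t in 𝓝[<] T, ∀ x, Real.sqrt (T - t) * ‖u t x‖ ≤ 2 * Real.sqrt ν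

/-! ## Registered stubs -/

/-- **S1 — depletion below one half** (NEW; the line's load-bearing stub for rung two; falsifiable by a single
divergence-free field with `|∫det(u,ω,curl ω)| > ½‖u‖_∞‖ω‖₂‖∇ω‖₂`). Saturation of Cauchy–Schwarz needs
`u ⊥ ω ⊥ curl ω ⊥ u` pointwise, `|u| ≡ ‖u‖_∞` on `supp ω` and `|curl ω| ∝ |ω|` for a field tied to `u` by
`ω = curl u`; every 1D-dependent or single-shell configuration has zero stretching (`J = ∫det(u, ω, −Δu)`), and
scale-separated triads are suppressed by transversality (card §Stubs). `L^∞`-constrained analogue of the Lu–Doering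
maximal enstrophy-production problem. Stated as `∃ κ < 1/2` (the weakest form rung
two needs). -/
theorem stub_depletionBelowHalf : ∃ κ : ℝ, κ < 1 / 2 ∧ StretchingDepletion κ := by
  sorry

/-- **S2 — a depletion constant closes every rung below its reciprocal** (provable, L-sized, on rung one's
infrastructure: enstrophy balance `dZ/dt = 2∫⟪ω, Du ω⟫ − 2ν‖∇ω‖₂²` for classical Schwartz-datum solutions on
Tao sub-slabs, depletion + Young `2κM√(ZW) − 2νW ≤ κ²M²Z/(2ν)`, the rate `M(t)² ≤ C²ν/(T−t)`, Grönwall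
`Z(t) ≲ (T−t)^{−κ²C²/2}`, against the Leray/Tao `H¹` blow-up rate `(E+Z)²(T−t) ≥ cν³` at a singular time:
contradiction iff `κC < 1`; the case `κ = 1` is the enstrophy rung `C < 1`, `budgetCloses_two_iff`). -/
theorem stub_rung_of_depletion :
    ∀ κ : ℝ, 0 < κ → StretchingDepletion κ → ∀ C : ℝ, 0 < C → κ * C < 1 → Rung C := by
  sorry

/-- **S3 — descent to rung two** (OPEN; the crux minus rung two — carries the Type-I Liouville problem:
`NoTypeIBlowup ↔ Rung 2 ∧ DescentToRungTwo`, strategist glue file; ⇐ `SymmetryModuliCount.ForcedSymmetry`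
stmt-4052 via p106694; implied by `DescentToRungOne` stmt-14842. Declared as the residual, not to be worked
inside this line). -/
theorem stub_descentToRungTwo : DescentToRungTwo := by
  sorry

/-! ## Composition (kernel-checked, no sorry) -/

/-- Depletion is monotone in the constant. -/
theorem stretchingDepletion_mono {κ κ' : ℝ} (h : StretchingDepletion κ) (hle : κ ≤ κ') :
    StretchingDepletion κ' := by
  intro u M hu hdiv hM hω hDω hJ
  have hM0 : 0 ≤ M := (norm_nonneg (u 0)).trans (hM 0)
  refine (h u M hu hdiv hM hω hDω hJ).trans ?_
  have hA : 0 ≤ Real.sqrt (∫ x, ‖curl u x‖ ^ 2) := Real.sqrt_nonneg _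
  have hB : 0 ≤ Real.sqrt (∫ x, frobeniusNormSq (fderiv ℝ (curl u) x)) := Real.sqrt_nonneg _
  have h1 : κ * M ≤ κ' * M := mul_le_mul_of_nonneg_right hle hM0
  have h2 : κ * M * Real.sqrt (∫ x, ‖curl u x‖ ^ 2) ≤ κ' * M * Real.sqrt (∫ x, ‖curl u x‖ ^ 2) :=
    mul_le_mul_of_nonneg_right h1 hA
  exact mul_le_mul_of_nonneg_right h2 hB

/-- S1 + S2 give RUNG TWO: replace `κ` by `max κ (1/4) ∈ (0, 1/2)` and apply S2 at `C = 2`. -/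
theorem rungTwo_of_parts (h1 : ∃ κ : ℝ, κ < 1 / 2 ∧ StretchingDepletion κ)
    (h2 : ∀ κ : ℝ, 0 < κ → StretchingDepletion κ → ∀ C : ℝ, 0 < C → κ * C < 1 → Rung C) :
    Rung 2 := by
  obtain ⟨κ, hκ, hdep⟩ := h1
  have hpos : (0 : ℝ) < max κ (1 / 4) := lt_max_of_lt_right (by norm_num)
  have hlt : max κ (1 / 4) < 1 / 2 := max_lt hκ (by norm_num)
  have hdep' : StretchingDepletion (max κ (1 / 4)) := stretchingDepletion_mono hdep (le_max_left _ _)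
  exact h2 _ hpos hdep' 2 (by norm_num) (by linarith)

/-- Rung two and the descent to rung two give the crux (the amplitude-split glue at level two, through the
route's proved `LadderGlue`): it suffices to prove every rung `X_C`; raise the level to `max C 2`, descend,
extend by rung two. -/
theorem noTypeIBlowup_of_rungTwo_of_descent (hR2 : Rung 2) (hD2 : DescentToRungTwo) :
    Summit.NavierStokesRegularity.NavierStokesRegularity.Theses.TypeICertificateLadder.NoTypeIBlowup := by
  refine Summit.NavierStokesRegularity.NavierStokesRegularity.Theses.TypeICertificateLadder.LadderGlue_holds
    fun C _ => ?_
  intro ν T hν hT u p hcl hLH hdec hrate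
  by_contra hext
  have hrate' : ∀ᶠ t in 𝓝[<] T, ∀ x, Real.sqrt (T - t) * ‖u t x‖ ≤ max C 2 * Real.sqrt ν := by
    filter_upwards [hrate] with t ht
    intro x
    exact (ht x).trans (mul_le_mul_of_nonneg_right (le_max_left _ _) (Real.sqrt_nonneg ν))
  exact hext (hR2 ν T hν hT u p hcl hLH hdec
    (hD2 (max C 2) (le_max_right _ _) ν T hν hT u p hcl hLH hdec hrate' hext))

/-- **Composition** `S1 → S2 → S3 → crux`. -/
theorem NoTypeIBlowup_of_parts
    (h1 : ∃ κ : ℝ, κ < 1 / 2 ∧ StretchingDepletion κ)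
    (h2 : ∀ κ : ℝ, 0 < κ → StretchingDepletion κ → ∀ C : ℝ, 0 < C → κ * C < 1 → Rung C)
    (h3 : DescentToRungTwo) :
    Summit.NavierStokesRegularity.NavierStokesRegularity.Theses.TypeICertificateLadder.NoTypeIBlowup :=
  noTypeIBlowup_of_rungTwo_of_descent (rungTwo_of_parts h1 h2) h3

/-- The crux BY NAME from the three registered stubs. -/
theorem NoTypeIBlowup_of :
    Summit.NavierStokesRegularity.NavierStokesRegularity.Theses.TypeICertificateLadder.NoTypeIBlowup :=
  NoTypeIBlowup_of_parts stub_depletionBelowHalf stub_rung_of_depletion stub_descentToRungTwo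

/-- The same term typed as `ThreadingFlux.Target` (the crux's name in its other primary route). -/
theorem Target_of : Summit.NavierStokesRegularity.NavierStokesRegularity.Theses.ThreadingFlux.Target :=
  NoTypeIBlowup_of

/-! ## Logical position of the stubs (kernel-checked; for the costume check)

* S3 alone does not give the crux; the crux gives S3 vacuously and gives `Rung 2`; `Rung 2 ∧ S3 ↔ crux`.
* S1 ∧ S2 give exactly the rungs `X_C`, `C < 1/κ` — never the limit (`κ > 0`): the line is honest about
  what it can and cannot reach. -/

/-- The crux gives the descent vacuously (so S3 is a CONSEQUENCE of the crux: no hidden strength). -/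
theorem descentToRungTwo_of_noTypeIBlowup
    (hI : Summit.NavierStokesRegularity.NavierStokesRegularity.Theses.TypeICertificateLadder.NoTypeIBlowup) :
    DescentToRungTwo := by
  intro C _ ν T hν hT u p hcl hLH hdec hrate hext
  refine absurd (hI ν T hν hT u p hcl hLH hdec ⟨C * Real.sqrt ν, ?_⟩) hext
  have hlt : ∀ᶠ t in 𝓝[<] T, t < T := self_mem_nhdsWithin
  filter_upwards [hrate, hlt] with t ht htT
  intro x
  have hTt : 0 < Real.sqrt (T - t) := Real.sqrt_pos.2 (sub_pos.2 htT)
  rw [le_div_iff₀ hTt, mul_comm]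
  exact ht x

/-- The crux gives rung two (so `Rung 2 ∧ DescentToRungTwo ↔ crux` with the two theorems above). -/
theorem rungTwo_of_noTypeIBlowup
    (hI : Summit.NavierStokesRegularity.NavierStokesRegularity.Theses.TypeICertificateLadder.NoTypeIBlowup) :
    Rung 2 := by
  intro ν T hν hT u p hcl hLH hdec hrate
  refine hI ν T hν hT u p hcl hLH hdec ⟨2 * Real.sqrt ν, ?_⟩
  have hlt : ∀ᶠ t in 𝓝[<] T, t < T := self_mem_nhdsWithin
  filter_upwards [hrate, hlt] with t ht htT
  intro x
  have hTt : 0 < Real.sqrt (T - t) := Real.sqrt_pos.2 (sub_pos.2 htT)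
  rw [le_div_iff₀ hTt, mul_comm]
  exact ht x

theorem noTypeIBlowup_iff_rungTwo_and_descent :
    Summit.NavierStokesRegularity.NavierStokesRegularity.Theses.TypeICertificateLadder.NoTypeIBlowup ↔
      (Rung 2 ∧ DescentToRungTwo) :=
  ⟨fun h => ⟨rungTwo_of_noTypeIBlowup h, descentToRungTwo_of_noTypeIBlowup h⟩,
    fun h => noTypeIBlowup_of_rungTwo_of_descent h.1 h.2⟩

end Summit.NavierStokesRegularity.NavierStokesRegularity.Cruxes.Target.DepletionLadder

end
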